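import Mathlib
import Summits.Ventures.PercRepro.PuncturedLYMSplit

/-!
# PercRepro — (SP) BY FIBRATION OVER A SET `C`: THE GLUING LEMMA FOR ALL THE POINTS OF A MEMBER AT ONCE
(p10, gen 37)

Gen 36 split a flow problem at ONE point.  Here the ground set `S` is split along a subset `C ⊆ S` (a member of the
co-hyperplane family, or any set): a row `X` is the disjoint union of `A = X ∩ C` and `Z = X ∖ C`, and the columns
above `X` are either HORIZONTAL (`X ∪ {c}`, `c ∈ C ∖ X`: the same `Z`, one more point of `C`) or VERTICAL (`X ∪ {y}`,
`y ∉ C`: the same `A`, one more point outside `C`).  The vertical edges over a fixed `A` form the FIBRE instance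
`(S ∖ C, j − #A, fibRows P C A)`.  THE FIBRATION LEMMA (`hasFlow_fibration`): choose horizontal weights
`h X c ≥ 0`; if every fibre has a flow with row masses `ρ(A ∪ Z) − Σ_{c ∈ C ∖ A} h (A ∪ Z) c` (what is left of the row
after the horizontal edges) and column demands `ν(A ∪ W) − Σ_{c ∈ A} [(A ∖ c) ∪ W ∈ P]·h ((A ∖ c) ∪ W) c` (what is left of
the column after the horizontal inflow), and the columns inside `C` are paid horizontally, then the instance has a
flow.  Nothing here asserts (SP); the lemma is the bookkeeping of the symmetric («fibration») flows of a co-hyperplane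
family with pairwise disjoint members, where the fibres are the instances of the other members.
-/

namespace PercRepro.PuncturedLYM.Split

open Finset

variable {α : Type} [DecidableEq α]

/-- The rows of the fibre over `A`: the parts outside `C` of the rows meeting `C` exactly in `A`. -/
def fibRows (P : Finset (Finset α)) (C A : Finset α) : Finset (Finset α) :=
  (P.filter (fun X => X ∩ C = A)).image (fun X => X \ C)

/-- For `A ⊆ C`: `Z` is a fibre row over `A` iff `Z` avoids `C` and `A ∪ Z` is a row. -/
theorem mem_fibRows {P : Finset (Finset α)} {C A Z : Finset α} (hA : A ⊆ C) :
    Z ∈ fibRows P C A ↔ Disjoint Z C ∧ A ∪ Z ∈ P := by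
  simp only [fibRows, mem_image, mem_filter]
  constructor
  · rintro ⟨X, ⟨hXP, hXC⟩, rfl⟩
    refine ⟨sdiff_disjoint, ?_⟩
    have hX : A ∪ X \ C = X := by
      rw [← hXC, union_comm]
      exact sdiff_union_inter X C
    rwa [hX]
  · rintro ⟨hZC, hP⟩
    refine ⟨A ∪ Z, ⟨hP, ?_⟩, ?_⟩
    · rw [union_inter_distrib_right, inter_eq_left.2 hA, disjoint_iff_inter_eq_empty.1 hZC, union_empty]
    · rw [union_sdiff_distrib, sdiff_eq_empty_iff_subset.2 hA, empty_union, Finset.sdiff_eq_self_iff_disjoint.2 hZC]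

/-- The rows below a `(j+1)`-set `Y` are the `Y ∖ y`, `y ∈ Y`, that are rows (`P` a family of `j`-sets). -/
theorem subs_eq_image_erase {P : Finset (Finset α)} {j : ℕ} (hP : ∀ X ∈ P, X.card = j) {Y : Finset α}
    (hY : Y.card = j + 1) : subs P Y = (Y.filter (fun y => Y.erase y ∈ P)).image (fun y => Y.erase y) := by
  ext X
  simp only [mem_subs, mem_image, mem_filter]
  constructor
  · rintro ⟨hXP, hXY⟩
    have hc : (Y \ X).card = 1 := by rw [card_sdiff_of_subset hXY, hY, hP X hXP]; omega
    obtain ⟨y, hy⟩ := card_eq_one.1 hc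
    have hyY : y ∈ Y := (mem_sdiff.1 (hy ▸ mem_singleton_self y)).1
    have hyX : y ∉ X := (mem_sdiff.1 (hy ▸ mem_singleton_self y)).2
    have hXeq : X = Y.erase y := by
      ext z
      rw [mem_erase]
      constructor
      · intro hz; exact ⟨fun h => hyX (h ▸ hz), hXY hz⟩
      · rintro ⟨hzy, hzY⟩
        by_contra hzX
        have : z ∈ Y \ X := mem_sdiff.2 ⟨hzY, hzX⟩
        rw [hy, mem_singleton] at this
        exact hzy this
    exact ⟨y, ⟨hyY, hXeq ▸ hXP⟩, hXeq.symm⟩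
  · rintro ⟨y, ⟨hyY, hP'⟩, rfl⟩
    exact ⟨hP', erase_subset y Y⟩

/-- Sums over the rows below `Y` are sums over the removed point. -/
theorem sum_subs_eq_sum_erase {P : Finset (Finset α)} {j : ℕ} (hP : ∀ X ∈ P, X.card = j) {Y : Finset α}
    (hY : Y.card = j + 1) (f : Finset α → ℚ) :
    ∑ X ∈ subs P Y, f X = ∑ y ∈ Y.filter (fun y => Y.erase y ∈ P), f (Y.erase y) := by
  rw [subs_eq_image_erase hP hY]
  exact sum_image ((erase_injOn Y).mono (fun y hy => (mem_filter.1 hy).1))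

/-- `insert y X ∖ X = {y}` for `y ∉ X`. -/
theorem insert_sdiff_self_eq_singleton {X : Finset α} {y : α} (hy : y ∉ X) : insert y X \ X = {y} := by
  ext z
  simp only [mem_sdiff, mem_insert, mem_singleton]
  constructor
  · rintro ⟨h1 | h1, h2⟩
    · exact h1
    · exact absurd h1 h2
  · rintro rfl
    exact ⟨Or.inl rfl, hy⟩

/-- `Y ∖ (Y ∖ y) = {y}` for `y ∈ Y`. -/
theorem sdiff_erase_eq_singleton {Y : Finset α} {y : α} (hy : y ∈ Y) : Y \ Y.erase y = {y} := by
  ext z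
  simp only [mem_sdiff, mem_erase, mem_singleton, not_and]
  constructor
  · rintro ⟨hzY, h⟩
    by_contra hzy
    exact h hzy hzY
  · rintro rfl
    exact ⟨hy, fun h _ => h rfl⟩

/-- **THE FIBRATION LEMMA.**  `C ⊆ S`, `P` a family of `j`-subsets of `S`, horizontal weights `h X c ≥ 0`.  If every
fibre over `A ⊆ C` with `#A ≤ j` has a flow with row masses `ρ(A ∪ Z) − Σ_{c ∈ C ∖ A} h (A ∪ Z) c` and column demands
`ν(A ∪ W) − Σ_{c ∈ A} [(A ∖ c) ∪ W ∈ P]·h ((A ∖ c) ∪ W) c`, and every column inside `C` is paid by its horizontal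
edges, then `(S, j, P, ρ, ν)` has a flow. -/
theorem hasFlow_fibration {S C : Finset α} (hC : C ⊆ S) {j : ℕ} {P : Finset (Finset α)}
    (hP : P ⊆ S.powersetCard j) {ρ ν : Finset α → ℚ} (h : Finset α → α → ℚ) (hh : ∀ X c, 0 ≤ h X c)
    (hfib : ∀ A ⊆ C, A.card ≤ j → HasFlow (S \ C) (j - A.card) (fibRows P C A)
      (fun Z => ρ (A ∪ Z) - ∑ c ∈ C \ A, h (A ∪ Z) c)
      (fun W => ν (A ∪ W) - ∑ c ∈ A, if (A.erase c) ∪ W ∈ P then h ((A.erase c) ∪ W) c else 0))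
    (htop : ∀ Y ∈ cols S j, Y ⊆ C → ∑ y ∈ Y, (if Y.erase y ∈ P then h (Y.erase y) y else 0) = ν Y) :
    HasFlow S j P ρ ν := by
  -- the fibre flows, with a zero default outside the hypothesis
  have hfib' : ∀ A : Finset α, ∃ w : Finset α → Finset α → ℚ, (∀ X Y, 0 ≤ w X Y) ∧
      (A ⊆ C → A.card ≤ j → IsFlow (S \ C) (j - A.card) (fibRows P C A)
        (fun Z => ρ (A ∪ Z) - ∑ c ∈ C \ A, h (A ∪ Z) c)
        (fun W => ν (A ∪ W) - ∑ c ∈ A, if (A.erase c) ∪ W ∈ P then h ((A.erase c) ∪ W) c else 0) w) := by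
    intro A
    by_cases hA : A ⊆ C ∧ A.card ≤ j
    · obtain ⟨w, hw⟩ := hfib A hA.1 hA.2
      exact ⟨w, hw.nonneg, fun _ _ => hw⟩
    · exact ⟨fun _ _ => 0, fun _ _ => le_rfl, fun h1 h2 => absurd ⟨h1, h2⟩ hA⟩
  choose wf hwf using hfib'
  have hPcard : ∀ X ∈ P, X.card = j := fun X hX => (mem_powersetCard.1 (hP hX)).2
  refine ⟨fun X Y => if Y \ X ⊆ C then ∑ c ∈ Y \ X, h X c else wf (X ∩ C) (X \ C) (Y \ C), ?_, ?_, ?_⟩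
  · -- nonnegativity
    intro X Y
    split_ifs
    · exact sum_nonneg (fun c _ => hh X c)
    · exact (hwf (X ∩ C)).1 _ _
  · -- row sums
    intro X hXP
    set A := X ∩ C with hA_def
    set Z := X \ C with hZ_def
    have hAC : A ⊆ C := inter_subset_right
    have hAj : A.card ≤ j := by rw [← hPcard X hXP]; exact card_le_card inter_subset_left
    have hXAZ : A ∪ Z = X := by rw [hA_def, hZ_def, union_comm]; exact sdiff_union_inter X C
    have hZmem : Z ∈ fibRows P C A := (mem_fibRows hAC).2 ⟨sdiff_disjoint, by rw [hXAZ]; exact hXP⟩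
    have hflow := ((hwf A).2 hAC hAj).row Z hZmem
    rw [sum_sups] at hflow ⊢
    simp only [hXAZ] at hflow
    -- split the added point: inside `C` (horizontal) or outside (vertical)
    rw [← sum_filter_add_sum_filter_not (S \ X) (fun y => y ∈ C)]
    have hpart1 : ∑ y ∈ (S \ X).filter (fun y => y ∈ C),
        (if insert y X \ X ⊆ C then ∑ c ∈ insert y X \ X, h X c else wf (X ∩ C) (X \ C) (insert y X \ C))
        = ∑ c ∈ C \ A, h X c := by
      have hset : (S \ X).filter (fun y => y ∈ C) = C \ A := by
        ext y
        simp only [mem_filter, mem_sdiff, hA_def, mem_inter, not_and]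
        constructor
        · rintro ⟨⟨_, hyX⟩, hyC⟩; exact ⟨hyC, fun h => absurd h hyX⟩
        · rintro ⟨hyC, h⟩; exact ⟨⟨hC hyC, fun hyX => h hyX hyC⟩, hyC⟩
      rw [hset]
      apply sum_congr rfl
      intro y hy
      have hyC : y ∈ C := (mem_sdiff.1 hy).1
      have hyX : y ∉ X := fun hyX => (mem_sdiff.1 hy).2 (mem_inter.2 ⟨hyX, hyC⟩)
      rw [insert_sdiff_self_eq_singleton hyX, if_pos (singleton_subset_iff.2 hyC), sum_singleton]
    have hpart2 : ∑ y ∈ (S \ X).filter (fun y => ¬ y ∈ C),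
        (if insert y X \ X ⊆ C then ∑ c ∈ insert y X \ X, h X c else wf (X ∩ C) (X \ C) (insert y X \ C))
        = ρ X - ∑ c ∈ C \ A, h X c := by
      rw [← hflow]
      have hset : (S \ X).filter (fun y => ¬ y ∈ C) = (S \ C) \ Z := by
        ext y
        simp only [mem_filter, mem_sdiff, hZ_def, not_and, not_not]
        constructor
        · rintro ⟨⟨hyS, hyX⟩, hyC⟩; exact ⟨⟨hyS, hyC⟩, fun hyX' => absurd hyX' hyX⟩
        · rintro ⟨⟨hyS, hyC⟩, h⟩; exact ⟨⟨hyS, fun hyX => hyC (h hyX)⟩, hyC⟩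
      rw [hset]
      apply sum_congr rfl
      intro y hy
      have hyC : y ∉ C := (mem_sdiff.1 (mem_sdiff.1 hy).1).2
      have hyX : y ∉ X := fun hyX => (mem_sdiff.1 hy).2 (mem_sdiff.2 ⟨hyX, hyC⟩)
      rw [insert_sdiff_self_eq_singleton hyX, if_neg (fun hsub => hyC (singleton_subset_iff.1 hsub)),
        insert_sdiff_of_notMem X hyC, ← hA_def, ← hZ_def]
    rw [hpart1, hpart2]
    ring
  · -- column sums
    intro Y hY
    obtain ⟨hYS, hYc⟩ := mem_cols.1 hY
    set A' := Y ∩ C with hA'_def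
    set W := Y \ C with hW_def
    have hA'C : A' ⊆ C := inter_subset_right
    have hYAW : A' ∪ W = Y := by rw [hA'_def, hW_def, union_comm]; exact sdiff_union_inter Y C
    rw [sum_subs_eq_sum_erase hPcard hYc]
    -- the removed point: in `C` (horizontal inflow) or outside (a vertical edge of the fibre over `A'`)
    rw [← sum_filter_add_sum_filter_not (Y.filter (fun y => Y.erase y ∈ P)) (fun y => y ∈ C)]
    have hpart1 : ∑ y ∈ (Y.filter (fun y => Y.erase y ∈ P)).filter (fun y => y ∈ C),
        (if Y \ Y.erase y ⊆ C then ∑ c ∈ Y \ Y.erase y, h (Y.erase y) c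
          else wf (Y.erase y ∩ C) (Y.erase y \ C) (Y \ C))
        = ∑ c ∈ A', if (A'.erase c) ∪ W ∈ P then h ((A'.erase c) ∪ W) c else 0 := by
      have hset : (Y.filter (fun y => Y.erase y ∈ P)).filter (fun y => y ∈ C)
          = A'.filter (fun c => (A'.erase c) ∪ W ∈ P) := by
        ext y
        simp only [mem_filter, hA'_def, hW_def, mem_inter]
        constructor
        · rintro ⟨⟨hyY, hP'⟩, hyC⟩
          refine ⟨⟨hyY, hyC⟩, ?_⟩
          have : (Y ∩ C).erase y ∪ Y \ C = Y.erase y := by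
            ext z
            simp only [mem_union, mem_erase, mem_inter, mem_sdiff]
            constructor
            · rintro (⟨hzy, hzY, _⟩ | ⟨hzY, hzC⟩)
              · exact ⟨hzy, hzY⟩
              · exact ⟨fun h => hzC (h ▸ hyC), hzY⟩
            · rintro ⟨hzy, hzY⟩
              by_cases hzC : z ∈ C
              · exact Or.inl ⟨hzy, hzY, hzC⟩
              · exact Or.inr ⟨hzY, hzC⟩
          rwa [this]
        · rintro ⟨⟨hyY, hyC⟩, hP'⟩
          refine ⟨⟨hyY, ?_⟩, hyC⟩
          have : (Y ∩ C).erase y ∪ Y \ C = Y.erase y := by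
            ext z
            simp only [mem_union, mem_erase, mem_inter, mem_sdiff]
            constructor
            · rintro (⟨hzy, hzY, _⟩ | ⟨hzY, hzC⟩)
              · exact ⟨hzy, hzY⟩
              · exact ⟨fun h => hzC (h ▸ hyC), hzY⟩
            · rintro ⟨hzy, hzY⟩
              by_cases hzC : z ∈ C
              · exact Or.inl ⟨hzy, hzY, hzC⟩
              · exact Or.inr ⟨hzY, hzC⟩
          rwa [this] at hP'
      rw [hset, sum_filter]
      apply sum_congr rfl
      intro c hc
      have hcY : c ∈ Y := (mem_inter.1 hc).1
      have hcC : c ∈ C := (mem_inter.1 hc).2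
      have hAW : (A'.erase c) ∪ W = Y.erase c := by
        ext z
        simp only [mem_union, mem_erase, hA'_def, hW_def, mem_inter, mem_sdiff]
        constructor
        · rintro (⟨hzy, hzY, _⟩ | ⟨hzY, hzC⟩)
          · exact ⟨hzy, hzY⟩
          · exact ⟨fun h => hzC (h ▸ hcC), hzY⟩
        · rintro ⟨hzy, hzY⟩
          by_cases hzC : z ∈ C
          · exact Or.inl ⟨hzy, hzY, hzC⟩
          · exact Or.inr ⟨hzY, hzC⟩
      rw [hAW, sdiff_erase_eq_singleton hcY, if_pos (singleton_subset_iff.2 hcC), sum_singleton]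
    rw [hpart1]
    -- columns inside `C`: no vertical edge
    by_cases hYC : Y ⊆ C
    · have hW0 : W = ∅ := sdiff_eq_empty_iff_subset.2 hYC
      have hA'Y : A' = Y := inter_eq_left.2 hYC
      have hempty : (Y.filter (fun y => Y.erase y ∈ P)).filter (fun y => ¬ y ∈ C) = ∅ := by
        apply filter_eq_empty_iff.2
        intro y hy hyC
        exact hyC (hYC (mem_filter.1 hy).1)
      rw [hempty, sum_empty, add_zero, ← htop Y hY hYC]
      refine sum_congr ?_ (fun c hc => ?_)
      · rw [hA'Y]
      · rw [hW0, union_empty, hA'Y]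
    · -- a column meeting the outside of `C`: its vertical rows are the fibre rows below `W`
      have hA'j : A'.card ≤ j := by
        have h1 : A'.card < Y.card := card_lt_card ⟨inter_subset_left, fun hsub => hYC (fun y hy => (mem_inter.1 (hsub hy)).2)⟩
        omega
      have hWcols : W ∈ cols (S \ C) (j - A'.card) := by
        rw [mem_cols]
        refine ⟨sdiff_subset_sdiff hYS subset_rfl, ?_⟩
        rw [hW_def, ← sdiff_inter_self_left Y C, card_sdiff_of_subset inter_subset_left, ← hA'_def, hYc]
        omega
      have hcol := ((hwf A').2 hA'C hA'j).col W hWcols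
      simp only [hYAW] at hcol
      have hpart2 : ∑ y ∈ (Y.filter (fun y => Y.erase y ∈ P)).filter (fun y => ¬ y ∈ C),
          (if Y \ Y.erase y ⊆ C then ∑ c ∈ Y \ Y.erase y, h (Y.erase y) c
            else wf (Y.erase y ∩ C) (Y.erase y \ C) (Y \ C))
          = ∑ Z ∈ subs (fibRows P C A') W, wf A' Z W := by
        have hfibcard : ∀ Z ∈ fibRows P C A', Z.card = j - A'.card := by
          intro Z hZ
          obtain ⟨hZC, hZP⟩ := (mem_fibRows hA'C).1 hZ
          have := hPcard _ hZP
          rw [card_union_of_disjoint (disjoint_of_subset_left hA'C hZC.symm)] at this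
          omega
        have hWc : W.card = (j - A'.card) + 1 := by
          rw [hW_def, ← sdiff_inter_self_left Y C, card_sdiff_of_subset inter_subset_left, ← hA'_def, hYc]; omega
        rw [sum_subs_eq_sum_erase hfibcard hWc]
        have hset : (Y.filter (fun y => Y.erase y ∈ P)).filter (fun y => ¬ y ∈ C)
            = W.filter (fun y => W.erase y ∈ fibRows P C A') := by
          ext y
          simp only [mem_filter, hW_def, mem_sdiff, mem_fibRows hA'C]
          have key : ∀ y ∈ Y, y ∉ C → A' ∪ (Y \ C).erase y = Y.erase y := by
            intro y hyY hyC
            ext z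
            simp only [mem_union, hA'_def, mem_inter, mem_erase, mem_sdiff]
            constructor
            · rintro (⟨hzY, hzC⟩ | ⟨hzy, hzY, _⟩)
              · exact ⟨fun h => hyC (h ▸ hzC), hzY⟩
              · exact ⟨hzy, hzY⟩
            · rintro ⟨hzy, hzY⟩
              by_cases hzC : z ∈ C
              · exact Or.inl ⟨hzY, hzC⟩
              · exact Or.inr ⟨hzy, hzY, hzC⟩
          constructor
          · rintro ⟨⟨hyY, hP'⟩, hyC⟩
            refine ⟨⟨hyY, hyC⟩, disjoint_of_subset_left (erase_subset y (Y \ C)) sdiff_disjoint, ?_⟩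
            rwa [key y hyY hyC]
          · rintro ⟨⟨hyY, hyC⟩, _, hP'⟩
            rw [key y hyY hyC] at hP'
            exact ⟨⟨hyY, hP'⟩, hyC⟩
        rw [hset]
        apply sum_congr rfl
        intro y hy
        have hyY : y ∈ Y := (mem_sdiff.1 (mem_filter.1 hy).1).1
        have hyC : y ∉ C := (mem_sdiff.1 (mem_filter.1 hy).1).2
        rw [sdiff_erase_eq_singleton hyY, if_neg (fun hsub => hyC (singleton_subset_iff.1 hsub))]
        have e1 : Y.erase y ∩ C = A' := by
          rw [hA'_def]
          ext z
          simp only [mem_inter, mem_erase]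
          constructor
          · rintro ⟨⟨_, hzY⟩, hzC⟩; exact ⟨hzY, hzC⟩
          · rintro ⟨hzY, hzC⟩; exact ⟨⟨fun h => hyC (h ▸ hzC), hzY⟩, hzC⟩
        have e2 : Y.erase y \ C = W.erase y := by
          rw [hW_def]
          ext z
          simp only [mem_sdiff, mem_erase]
          tauto
        rw [e1, e2, ← hW_def]
      rw [hpart2, hcol]
      ring

end PercRepro.PuncturedLYM.Split
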